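import Mathlib
import Summits.ValiantsHypothesis.ValiantsHypothesis.Theorems.BarrierLeverPartitionMinorsHitByVPHiddenStatesSecondShellSurjection

/-!
# Route BarrierLever — item `PartitionMinorsHitByVP` (stmt-ValiantsHypothesis-19717), line `hidden-states`:
# ★ THE MASTER THEOREM FOR CROSS MINORS — permanental LGV inversion and `D(A ← C') = ± Σ_S Sur[C',S]·DPS(S → A)`

Helper file (`--supports stmt-ValiantsHypothesis-19717`; cell valiant-natproofs, 𝒟-side door (c), registered line
`Cruxes/PartitionMinorsHitByVP/Lines/hidden_states.lean` v9; prover seat val-np-p6 gen 19).  Closes NO item; definition-free.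

THE THEOREM (memo HOME/val-np-p6/g19/MEMO-valnp6-g19.md §0–§1).  Let `w` be a table with unit diagonal whose reading digraph is
ACYCLIC (`w u v ≠ 0, u ≠ v ⇒ pot v < pot u`).  (A) ★ `dps_sum_sur` — PERMANENTAL LGV INVERSION: the signed vertex-disjoint path
systems invert the permanental compound, `Σ_R DPS(S' → R) · per(w[R,S]) = [S' = S]` (induction on the vertex set, peeling the top
vertex with the four lemmas of `…SecondShellSurjection`; the two mixed double sums cancel).  (B) ★★ `det_eq_zero_of_master` — for the
cross minor `D(A ← C')` (rows: every set of size `≤ t` except `A`, plus the start row `C'`; columns of size `≤ t`): if the MASTER SUM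
`Λ = Σ_{|S| = t} Sur[C',S] · DPS(S → A)` vanishes then the determinant vanishes.  Proof: with `y_R = Σ_S Sur[C',S]·DPS(S → R)` one has
`Σ_R y_R · per(w[R,S]) = Sur[C',S]` by (A), so `row_{C'} − Σ_{R ≠ A} y_R row_R` has no component on the `t`-set indicators when
`y_A = Λ = 0`; it and all rows of size `< t` then live in the span of the `< t` indicators — one vector too many (dimension count as in
`…SecondShellTrapped.det_eq_zero_of_invariant`).  Every chain lemma of gen 17/18 is the special case «chain digraph»; the table-free
form (no REDUCED CONFIGURATION ⇒ `Λ = 0`, memo Theorem C) is the sequel.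

HONEST LABEL: conjecture-column toolkit (second shell, every `t, h`); 19717 stays OPEN; nothing on crux 14610 or VP ≠ VNP.
-/

set_option linter.dupNamespace false

namespace Summit.ValiantsHypothesis.ValiantsHypothesis.Theorems.BarrierLever.HiddenStates

open Finset

noncomputable section

namespace SecondShell

variable {ι : Type} [DecidableEq ι]

/-! ## ★ Theorem A — permanental LGV inversion -/

omit [DecidableEq ι] in
/-- in an acyclic table, the vertices below the top one do not read it. -/
theorem unread_of_top (w : ι → ι → ℂ) (pot : ι → ℕ) (hdag : ∀ u v, u ≠ v → w u v ≠ 0 → pot v < pot u)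
    {V : Finset ι} {m : ι} (hmV : m ∉ V) (hmax : ∀ x ∈ V, pot x ≤ pot m) : ∀ x ∈ V, w x m = 0 := by
  intro x hx
  by_contra h
  have hne : x ≠ m := fun h' => hmV (h' ▸ hx)
  have := hdag x m hne h
  have := hmax x hx
  omega

/-- ★ **PERMANENTAL LGV INVERSION** (memo Theorem A, right-inverse form): for an acyclic table with unit diagonal and
`S', S ⊆ V` of the same size, `Σ_{R ⊆ V, |R| = |S|} DPS_V(S' → R) · Sur[R, S] = [S' = S]`. -/
theorem dps_sum_sur (w : ι → ι → ℂ) (hdiag : ∀ u, w u u = 1) (pot : ι → ℕ)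
    (hdag : ∀ u v, u ≠ v → w u v ≠ 0 → pot v < pot u) (V : Finset ι) :
    ∀ S' S : Finset ι, S' ⊆ V → S ⊆ V → S'.card = S.card →
      ∑ R ∈ V.powersetCard S.card, dps w V S' R * sur w R S = if S' = S then 1 else 0 := by
  induction V using Finset.induction_on_max_value pot with
  | empty =>
    intro S' S hS' hS _
    rw [Finset.subset_empty.1 hS', Finset.subset_empty.1 hS]
    rw [Finset.card_empty, Finset.powersetCard_zero, Finset.sum_singleton, if_pos rfl, sur_empty_left, if_pos rfl, mul_one]
    unfold dps
    rw [Finset.powerset_empty, Finset.sum_singleton, if_pos ⟨le_rfl, le_rfl⟩]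
    simp [sur_empty_left]
  | insert m V hmV hmax ih =>
    have hVm : ∀ x ∈ V, w x m = 0 := unread_of_top w pot hdag hmV hmax
    intro S' S hS' hS hc
    -- split the rows `R` according to `m ∈ R`
    have hsplit : ∀ (k : ℕ) (F : Finset ι → ℂ), ∑ R ∈ (insert m V).powersetCard k, F R =
        ∑ R ∈ V.powersetCard k, F R + ∑ R₀ ∈ V.powersetCard (k - 1), if 1 ≤ k then F (insert m R₀) else 0 := by
      intro k F
      rcases k with _ | k
      · simp
      · rw [Finset.powersetCard_succ_insert hmV, Finset.sum_union, Finset.sum_image]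
        · simp
        · intro R₁ hR₁ R₂ hR₂ hEq
          have h1 : m ∉ R₁ := fun h => hmV (Finset.mem_powersetCard.1 hR₁ |>.1 h)
          have h2 : m ∉ R₂ := fun h => hmV (Finset.mem_powersetCard.1 hR₂ |>.1 h)
          rw [← Finset.erase_insert h1, hEq, Finset.erase_insert h2]
        · rw [Finset.disjoint_left]
          intro R hR hR'
          obtain ⟨R₀, hR₀, rfl⟩ := Finset.mem_image.1 hR'
          exact hmV (Finset.mem_powersetCard.1 hR |>.1 (Finset.mem_insert_self m R₀))
    -- rows inside `V` do not read `m`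
    have hunread : ∀ R ∈ V.powersetCard S.card, ∀ T : Finset ι, m ∈ T → sur w R T = 0 := fun R hR T hmT =>
      sur_eq_zero_of_unread w R T hmT fun u hu => hVm u (Finset.mem_powersetCard.1 hR |>.1 hu)
    rw [hsplit]
    by_cases hmS' : m ∈ S'
    · by_cases hmS : m ∈ S
      · -- case D: `m ∈ S'`, `m ∈ S`
        have hk : 1 ≤ S.card := Finset.card_pos.2 ⟨m, hmS⟩
        have hD2 : ∑ R ∈ V.powersetCard S.card, dps w (insert m V) S' R * sur w R S = 0 :=
          Finset.sum_eq_zero fun R hR => by rw [hunread R hR S hmS, mul_zero]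
        rw [hD2, zero_add]
        have hS'V : S'.erase m ⊆ V := fun x hx => by
          have := hS' (Finset.mem_of_mem_erase hx)
          exact (Finset.mem_insert.1 this).resolve_left (Finset.ne_of_mem_erase hx)
        have hSV : S.erase m ⊆ V := fun x hx => by
          have := hS (Finset.mem_of_mem_erase hx)
          exact (Finset.mem_insert.1 this).resolve_left (Finset.ne_of_mem_erase hx)
        have hce : (S'.erase m).card = (S.erase m).card := by
          rw [Finset.card_erase_of_mem hmS', Finset.card_erase_of_mem hmS, hc]
        have hIH := ih (S'.erase m) (S.erase m) hS'V hSV hce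
        rw [Finset.card_erase_of_mem hmS] at hIH
        have hiff : (S'.erase m = S.erase m) ↔ (S' = S) := by
          constructor
          · intro h; rw [← Finset.insert_erase hmS', h, Finset.insert_erase hmS]
          · intro h; rw [h]
        have hval : (if S' = S then (1 : ℂ) else 0) = if S'.erase m = S.erase m then 1 else 0 := by
          by_cases h : S' = S
          · rw [if_pos h, if_pos (hiff.2 h)]
          · rw [if_neg h, if_neg (fun h' => h (hiff.1 h'))]
        rw [hval, ← hIH]
        refine Finset.sum_congr rfl fun R₀ hR₀ => ?_
        rw [if_pos hk]
        have hmR₀ : m ∉ R₀ := fun h => hmV (Finset.mem_powersetCard.1 hR₀ |>.1 h)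
        have hR₀c : (R₀).card = S.card - 1 := (Finset.mem_powersetCard.1 hR₀).2
        rw [dps_insert_of_mem_mem w hmV hmS' (Finset.mem_insert_self m R₀), Finset.erase_insert hmR₀,
          sur_insert_of_card w hmR₀ S (by omega)]
        -- only `v = m` survives
        rw [← Finset.insert_erase hmS, Finset.sum_insert (Finset.notMem_erase m S), Finset.insert_erase hmS, hdiag, one_mul]
        rw [Finset.sum_eq_zero (fun v hv => ?_), add_zero]
        have hmSv : m ∈ S.erase v := Finset.mem_erase.2 ⟨(Finset.ne_of_mem_erase hv).symm, hmS⟩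
        rw [sur_eq_zero_of_unread w R₀ (S.erase v) hmSv (fun u hu => hVm u (Finset.mem_powersetCard.1 hR₀ |>.1 hu)),
          mul_zero]
      · -- case C: `m ∈ S'`, `m ∉ S`
        rw [if_neg (fun h : S' = S => hmS (by rw [← h]; exact hmS'))]
        have hSV : S ⊆ V := fun x hx => (Finset.mem_insert.1 (hS hx)).resolve_left (fun h => hmS (h ▸ hx))
        have hS'V : S'.erase m ⊆ V := fun x hx => by
          have := hS' (Finset.mem_of_mem_erase hx)
          exact (Finset.mem_insert.1 this).resolve_left (Finset.ne_of_mem_erase hx)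
        have hk : 1 ≤ S.card := by rw [← hc]; exact Finset.card_pos.2 ⟨m, hmS'⟩
        -- C2: rows avoiding `m`, first edge `m → v`
        have hC2 : ∑ R ∈ V.powersetCard S.card, dps w (insert m V) S' R * sur w R S =
            ∑ v ∈ V, if v ∉ S' ∧ insert v (S'.erase m) = S then -w m v else 0 := by
          have h1 : ∀ R ∈ V.powersetCard S.card, dps w (insert m V) S' R * sur w R S =
              ∑ v ∈ V, (if v ∉ S' then (-w m v) * (dps w V (insert v (S'.erase m)) R * sur w R S) else 0) := by
            intro R hR
            have hRc : R.card = S.card := (Finset.mem_powersetCard.1 hR).2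
            have hmR : m ∉ R := fun h => hmV (Finset.mem_powersetCard.1 hR |>.1 h)
            rw [dps_insert_of_mem_notMem w hmV hmS' hmR (by rw [hRc, hc]), Finset.sum_mul]
            rw [← Finset.sum_subset (Finset.sdiff_subset : V \ S' ⊆ V)]
            · refine Finset.sum_congr rfl fun v hv => ?_
              rw [if_pos (Finset.mem_sdiff.1 hv).2, mul_assoc]
            · intro v hvV hv
              rw [if_neg (fun h => hv (Finset.mem_sdiff.2 ⟨hvV, h⟩))]
          rw [Finset.sum_congr rfl h1, Finset.sum_comm]
          refine Finset.sum_congr rfl fun v hvV => ?_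
          by_cases hvS' : v ∉ S'
          · simp only [if_pos hvS', ← Finset.mul_sum]
            have hsub : insert v (S'.erase m) ⊆ V := Finset.insert_subset hvV hS'V
            have hcard : (insert v (S'.erase m)).card = S.card := by
              rw [Finset.card_insert_of_notMem (fun h => hvS' (Finset.mem_of_mem_erase h)),
                Finset.card_erase_of_mem hmS', hc]; omega
            rw [ih _ S hsub hSV hcard]
            by_cases hEq : insert v (S'.erase m) = S
            · rw [if_pos hEq, if_pos ⟨hvS', hEq⟩, mul_one]
            · rw [if_neg hEq, if_neg (fun h => hEq h.2), mul_zero]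
          · rw [Finset.sum_eq_zero (fun R _ => by rw [if_neg hvS']), if_neg (fun h => hvS' h.1)]
        -- C1: rows through `m`, the token `m` steps to `v ∈ S`
        have hC1 : ∑ R₀ ∈ V.powersetCard (S.card - 1), (if 1 ≤ S.card then
            dps w (insert m V) S' (insert m R₀) * sur w (insert m R₀) S else 0) =
            ∑ v ∈ V, if v ∈ S ∧ S'.erase m = S.erase v then w m v else 0 := by
          have h1 : ∀ R₀ ∈ V.powersetCard (S.card - 1), (if 1 ≤ S.card then
              dps w (insert m V) S' (insert m R₀) * sur w (insert m R₀) S else 0) =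
              ∑ v ∈ V, (if v ∈ S then w m v * (dps w V (S'.erase m) R₀ * sur w R₀ (S.erase v)) else 0) := by
            intro R₀ hR₀
            have hmR₀ : m ∉ R₀ := fun h => hmV (Finset.mem_powersetCard.1 hR₀ |>.1 h)
            have hR₀c : R₀.card = S.card - 1 := (Finset.mem_powersetCard.1 hR₀).2
            rw [if_pos hk, dps_insert_of_mem_mem w hmV hmS' (Finset.mem_insert_self m R₀), Finset.erase_insert hmR₀,
              sur_insert_of_card w hmR₀ S (by omega), Finset.mul_sum]
            rw [← Finset.sum_subset hSV]
            · refine Finset.sum_congr rfl fun v hv => ?_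
              rw [if_pos hv]; ring
            · intro v _ hv; rw [if_neg hv]
          rw [Finset.sum_congr rfl h1, Finset.sum_comm]
          refine Finset.sum_congr rfl fun v hvV => ?_
          by_cases hvS : v ∈ S
          · simp only [if_pos hvS, ← Finset.mul_sum]
            have hcard : (S'.erase m).card = (S.erase v).card := by
              rw [Finset.card_erase_of_mem hmS', Finset.card_erase_of_mem hvS, hc]
            have hIH := ih (S'.erase m) (S.erase v) hS'V (fun x hx => hSV (Finset.mem_of_mem_erase hx)) hcard
            rw [Finset.card_erase_of_mem hvS] at hIH
            rw [hIH]
            by_cases hEq : S'.erase m = S.erase v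
            · rw [if_pos hEq, if_pos ⟨hvS, hEq⟩, mul_one]
            · rw [if_neg hEq, if_neg (fun h => hEq h.2), mul_zero]
          · rw [Finset.sum_eq_zero (fun R _ => by rw [if_neg hvS]), if_neg (fun h => hvS h.1)]
        rw [hC1, hC2, ← Finset.sum_add_distrib]
        refine Finset.sum_eq_zero fun v hvV => ?_
        -- the two indicator conditions coincide
        have hiff : (v ∉ S' ∧ insert v (S'.erase m) = S) ↔ (v ∈ S ∧ S'.erase m = S.erase v) := by
          constructor
          · rintro ⟨hvS', hEq⟩
            refine ⟨hEq ▸ Finset.mem_insert_self v _, ?_⟩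
            rw [← hEq, Finset.erase_insert (fun h => hvS' (Finset.mem_of_mem_erase h))]
          · rintro ⟨hvS, hEq⟩
            have hvm : v ≠ m := fun h => hmS (h ▸ hvS)
            have hvS' : v ∉ S' := fun h => by
              have : v ∈ S'.erase m := Finset.mem_erase.2 ⟨hvm, h⟩
              rw [hEq] at this; exact Finset.notMem_erase v S this
            exact ⟨hvS', by rw [hEq, Finset.insert_erase hvS]⟩
        by_cases h : v ∈ S ∧ S'.erase m = S.erase v
        · rw [if_pos (hiff.2 h), if_pos h]; ring
        · rw [if_neg (fun h' => h (hiff.1 h')), if_neg h, add_zero]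
    · by_cases hmS : m ∈ S
      · -- case B: `m ∉ S'`, `m ∈ S`
        rw [if_neg (fun h : S' = S => hmS' (by rw [h]; exact hmS))]
        rw [Finset.sum_eq_zero (fun R hR => by rw [hunread R hR S hmS, mul_zero]), zero_add]
        refine Finset.sum_eq_zero fun R₀ hR₀ => ?_
        split_ifs with hk
        · rw [dps_insert_of_notMem_mem w hmV hVm hmS' (Finset.mem_insert_self m R₀), zero_mul]
        · rfl
      · -- case A: `m ∉ S'`, `m ∉ S`
        have hS'V : S' ⊆ V := fun x hx => (Finset.mem_insert.1 (hS' hx)).resolve_left (fun h => hmS' (h ▸ hx))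
        have hSV : S ⊆ V := fun x hx => (Finset.mem_insert.1 (hS hx)).resolve_left (fun h => hmS (h ▸ hx))
        rw [Finset.sum_eq_zero (s := V.powersetCard (S.card - 1)) (fun R₀ hR₀ => ?_), add_zero]
        · rw [← ih S' S hS'V hSV hc]
          refine Finset.sum_congr rfl fun R hR => ?_
          have hmR : m ∉ R := fun h => hmV (Finset.mem_powersetCard.1 hR |>.1 h)
          rw [dps_insert_of_notMem_notMem w hmV hVm hmS' hmR]
        · split_ifs with hk
          · rw [dps_insert_of_notMem_mem w hmV hVm hmS' (Finset.mem_insert_self m R₀), zero_mul]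
          · rfl

/-! ## ★★ Theorem B+A — the master theorem for cross minors -/

/-- ★★ **THE MASTER THEOREM FOR CROSS MINORS.**  Acyclic table `w` with unit diagonal on a finite vertex type; rows: the start row
`rows i₀ = C'` and, among the other rows, every set of size `≤ t` other than `A` (`|A| = t`, `|C'| = t + 1`); columns of size `≤ t`.
If the master sum `Λ = Σ_{|S| = t} Sur[C',S] · DPS(S → A)` vanishes, the determinant vanishes. -/
theorem det_eq_zero_of_master [Fintype ι] (w : ι → ι → ℂ) (hdiag : ∀ u, w u u = 1) (pot : ι → ℕ)
    (hdag : ∀ u v, u ≠ v → w u v ≠ 0 → pot v < pot u)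
    (t : ℕ) {r : ℕ} (rows cols : Fin r → Finset ι) (i₀ : Fin r) (C' A : Finset ι)
    (hrow : rows i₀ = C') (hC' : C'.card = t + 1) (hA : A.card = t)
    (hall : ∀ S : Finset ι, S.card ≤ t → S ≠ A → ∃ i, i ≠ i₀ ∧ rows i = S)
    (hcol : ∀ kk, (cols kk).card ≤ t)
    (hΛ : ∑ S ∈ (Finset.univ : Finset ι).powersetCard t, sur w C' S * dps w Finset.univ S A = 0) :
    (mat w rows cols).det = 0 := by
  classical
  set M : Matrix (Fin r) (Fin r) ℂ := mat w rows cols with hM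
  set tsets : Finset (Finset ι) := (Finset.univ : Finset ι).powersetCard t with htsets
  have hAt : A ∈ tsets := Finset.mem_powersetCard.2 ⟨Finset.subset_univ _, hA⟩
  -- the coefficients `y_R = Σ_S Sur[C',S]·DPS(S → R)` and the key identity `Σ_R y_R Sur[R,S] = Sur[C',S]`
  set y : Finset ι → ℂ := fun R => ∑ S ∈ tsets, sur w C' S * dps w Finset.univ S R with hy
  have hyA : y A = 0 := hΛ
  have hkey : ∀ S ∈ tsets, ∑ R ∈ tsets, y R * sur w R S = sur w C' S := by
    intro S hS
    have hSc : S.card = t := (Finset.mem_powersetCard.1 hS).2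
    have h1 : ∑ R ∈ tsets, y R * sur w R S = ∑ S₁ ∈ tsets, sur w C' S₁ * ∑ R ∈ tsets, dps w Finset.univ S₁ R * sur w R S := by
      simp only [hy, Finset.sum_mul, Finset.mul_sum]
      rw [Finset.sum_comm]
      exact Finset.sum_congr rfl fun S₁ _ => Finset.sum_congr rfl fun R _ => by ring
    rw [h1]
    have h2 : ∀ S₁ ∈ tsets, sur w C' S₁ * ∑ R ∈ tsets, dps w Finset.univ S₁ R * sur w R S =
        if S₁ = S then sur w C' S₁ else 0 := by
      intro S₁ hS₁
      have hS₁c : S₁.card = S.card := by rw [(Finset.mem_powersetCard.1 hS₁).2, hSc]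
      rw [htsets, ← hSc, dps_sum_sur w hdiag pot hdag Finset.univ S₁ S (Finset.subset_univ _) (Finset.subset_univ _) hS₁c]
      split_ifs <;> simp
    rw [Finset.sum_congr rfl h2, Finset.sum_ite_eq' tsets S, if_pos hS]
  -- indices of the needed rows
  have hall' : ∀ S : Finset ι, S.card ≤ t ∧ S ≠ A → ∃ i, i ≠ i₀ ∧ rows i = S := fun S h => hall S h.1 h.2
  haveI : Nonempty (Fin r) := ⟨i₀⟩
  choose! idx hidx using hall'
  -- row operation: subtract `Σ_{R ≠ A} y_R · row_R` from the start row
  set v : Fin r → ℂ := M i₀ - ∑ R ∈ tsets.erase A, y R • M (idx R) with hv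
  have hdetM : (M.updateRow i₀ v).det = M.det := by
    have hv' : v = M i₀ + ∑ R ∈ tsets.erase A, (-y R) • M (idx R) := by
      rw [hv, sub_eq_add_neg, ← Finset.sum_neg_distrib]
      congr 1
      exact Finset.sum_congr rfl fun R _ => by rw [neg_smul]
    rw [hv', Matrix.det_updateRow_add, Matrix.updateRow_eq_self, det_updateRow_sum', add_eq_left]
    refine Finset.sum_eq_zero fun R hR => ?_
    have hR' := Finset.mem_erase.1 hR
    have hRt : R.card = t := (Finset.mem_powersetCard.1 hR'.2).2
    obtain ⟨hne, -⟩ := hidx R ⟨le_of_eq hRt, hR'.1⟩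
    rw [Matrix.det_updateRow_eq_zero hne, mul_zero]
  rw [← hdetM]
  set M' := M.updateRow i₀ v with hM'
  -- the indicators of the small sets and their span
  set small : Finset (Finset ι) := Finset.univ.filter fun S : Finset ι => S.card < t with hsmall
  set χ : Finset ι → (Fin r → ℂ) := fun S kk => if S ⊆ cols kk then 1 else 0 with hχ
  set X : Submodule ℂ (Fin r → ℂ) := Submodule.span ℂ (↑(small.image χ) : Set (Fin r → ℂ)) with hX
  have hχX : ∀ S ∈ small, χ S ∈ X := fun S hS => Submodule.subset_span (Finset.mem_image_of_mem χ hS)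
  -- every row of `M` is the sum of its surjection parts against the indicators
  have hMrow : ∀ i, M i = ∑ S ∈ (Finset.univ : Finset (Finset ι)), sur w (rows i) S • χ S := by
    intro i; funext kk
    rw [Finset.sum_apply]
    simp only [Pi.smul_apply, smul_eq_mul, hχ, mul_ite, mul_one, mul_zero]
    rw [← Finset.sum_filter]
    have hf : (Finset.univ : Finset (Finset ι)).filter (fun S => S ⊆ cols kk) = (cols kk).powerset := by
      ext S; simp
    rw [hf, hM, mat_apply_eq_sum_sur]
  -- (i) small rows live in `X`
  have hsmallX : ∀ i, (rows i).card < t → M' i ∈ X := by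
    intro i hi
    have hii₀ : i ≠ i₀ := by rintro rfl; rw [hrow, hC'] at hi; omega
    rw [hM', Matrix.updateRow_ne hii₀, hMrow i]
    refine Submodule.sum_mem _ fun S _ => ?_
    by_cases hS : S.card < t
    · exact Submodule.smul_mem _ _ (hχX S (Finset.mem_filter.2 ⟨Finset.mem_univ _, hS⟩))
    · rw [sur_eq_zero_of_card_lt w (rows i) S (by omega), zero_smul]; exact Submodule.zero_mem _
  -- (ii) the reduced start row lives in `X`
  have hvX : M' i₀ ∈ X := by
    rw [hM', Matrix.updateRow_self]
    have hvsum : v = ∑ S ∈ (Finset.univ : Finset (Finset ι)),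
        (sur w C' S - ∑ R ∈ tsets.erase A, y R * sur w R S) • χ S := by
      rw [hv, hMrow i₀, hrow]
      rw [Finset.sum_congr rfl (fun R (_ : R ∈ tsets.erase A) => by rw [hMrow (idx R), Finset.smul_sum])]
      rw [Finset.sum_comm, ← Finset.sum_sub_distrib]
      refine Finset.sum_congr rfl fun S _ => ?_
      rw [sub_smul, Finset.sum_smul]
      congr 1
      refine Finset.sum_congr rfl fun R hR => ?_
      have hR' := Finset.mem_erase.1 hR
      obtain ⟨-, hrowsR⟩ := hidx R ⟨le_of_eq (Finset.mem_powersetCard.1 hR'.2).2, hR'.1⟩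
      rw [hrowsR, smul_smul]
    rw [hvsum]
    refine Submodule.sum_mem _ fun S _ => ?_
    by_cases hS : S.card < t
    · exact Submodule.smul_mem _ _ (hχX S (Finset.mem_filter.2 ⟨Finset.mem_univ _, hS⟩))
    by_cases hSt : S.card = t
    · -- the `t`-set components vanish: `Sur[C',S] − Σ_{R ≠ A} y_R Sur[R,S] = y_A Sur[A,S] = 0`
      have hS' : S ∈ tsets := Finset.mem_powersetCard.2 ⟨Finset.subset_univ _, hSt⟩
      have hcoef : sur w C' S - ∑ R ∈ tsets.erase A, y R * sur w R S = 0 := by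
        rw [← hkey S hS', ← Finset.add_sum_erase tsets _ hAt, hyA, zero_mul, zero_add, sub_self]
      rw [hcoef, zero_smul]; exact Submodule.zero_mem _
    · -- sets larger than `t` fit in no column
      have hχ0 : χ S = 0 := by
        funext kk
        simp only [hχ, Pi.zero_apply]
        rw [if_neg]
        intro hsub
        have := Finset.card_le_card hsub
        have := hcol kk
        omega
      rw [hχ0, smul_zero]; exact Submodule.zero_mem _
  -- (iii) one vector too many
  have hdim : Module.finrank ℂ X ≤ small.card :=
    (finrank_span_finset_le_card (small.image χ)).trans Finset.card_image_le
  set I : Finset (Fin r) := insert i₀ (small.image idx) with hI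
  have hIX : ∀ i ∈ I, M' i ∈ X := by
    intro i hi
    rcases Finset.mem_insert.1 hi with rfl | hi
    · exact hvX
    · obtain ⟨S, hS, rfl⟩ := Finset.mem_image.1 hi
      have hSc : S.card < t := (Finset.mem_filter.1 hS).2
      obtain ⟨-, hrowsS⟩ := hidx S ⟨le_of_lt hSc, fun h => by rw [h, hA] at hSc; omega⟩
      exact hsmallX _ (by rw [hrowsS]; exact hSc)
  have hcardI : I.card = small.card + 1 := by
    rw [hI, Finset.card_insert_of_notMem, Finset.card_image_of_injOn]
    · intro S hS S' hS' hEq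
      have h1 := (hidx S ⟨le_of_lt (Finset.mem_filter.1 (Finset.mem_coe.1 hS)).2,
        fun h => by have := (Finset.mem_filter.1 (Finset.mem_coe.1 hS)).2; rw [h, hA] at this; omega⟩).2
      have h2 := (hidx S' ⟨le_of_lt (Finset.mem_filter.1 (Finset.mem_coe.1 hS')).2,
        fun h => by have := (Finset.mem_filter.1 (Finset.mem_coe.1 hS')).2; rw [h, hA] at this; omega⟩).2
      rw [← h1, ← h2, hEq]
    · intro hi₀
      obtain ⟨S, hS, hiS⟩ := Finset.mem_image.1 hi₀
      have hSc : S.card < t := (Finset.mem_filter.1 hS).2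
      obtain ⟨hne, -⟩ := hidx S ⟨le_of_lt hSc, fun h => by rw [h, hA] at hSc; omega⟩
      exact hne hiS
  have hdep : ¬ LinearIndependent ℂ (fun i : I => M' i) := by
    intro hli
    rw [linearIndependent_iff_card_le_finrank_span, Fintype.card_coe] at hli
    have hle : Set.finrank ℂ (Set.range fun i : I => M' i) ≤ Module.finrank ℂ X := by
      apply Submodule.finrank_mono
      rw [Submodule.span_le]
      rintro _ ⟨i, rfl⟩
      exact hIX i i.2
    omega
  by_contra hdet
  have hU : IsUnit M' := (Matrix.isUnit_iff_isUnit_det M').2 (isUnit_iff_ne_zero.2 hdet)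
  have hrows : LinearIndependent ℂ M'.row := Matrix.linearIndependent_rows_iff_isUnit.2 hU
  exact hdep (hrows.comp (fun i : I => (i : Fin r)) Subtype.val_injective)

end SecondShell

end

end Summit.ValiantsHypothesis.ValiantsHypothesis.Theorems.BarrierLever.HiddenStates
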